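import Summits.BirchSwinnertonDyer.Rank1Residual.Additive.ChiBranchInputOdd
import HarnessLib

/-!
# X4 ∧ (semistable twist), `p ≡ 3 (mod 4)` (so `p = 3` first): the ODD `χ`-branch of Kato's divisibility for the big-image twist at `T = 0`, TYPED (cell `b2b-bsdres`, seat additive-p4, line V9b)

HONEST FRAMING (cell `b2b-bsdres`, run/shared/lean/b2b/bsd-rank1-residual/, verbatim in every
file): the goal of the cell is to DELETE the COMBINATION-SHAPED residual classes of the
Birch–Swinnerton-Dyer formula for ALL analytic-rank `≤ 1` elliptic curves over `ℚ` — "full BSD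
formula for every rank `≤ 1` curve in class `C`" assembled STRICTLY from published theorems — so
that the rank-`≤ 1` remainder becomes exactly the CONSTRUCTION-SHAPED classes, which are TYPED
(missing-input `Prop`s), NOT attempted. This is not "finishing BSD". The additive sub-cell (seats
additive-p1…p4) is a RESEARCH ROUTE on the construction-shaped classes X3/X4; no claim beyond the
stated classes; the label of X4 is UNCHANGED by this file.

Definitions only (one `def` + one unfolding lemma); NOTHING is asserted. Big-image twin of
`ChiBranchInputOdd.lean` (p203717), for the line V9b of HOME/b2b-bsdres-additive-p4/REPAIR-CENSUS.md:
the X4♯(3) block (additive `p = 3`, `E[3]` IRREDUCIBLE; SHARPENED §4: 1582 ‖ 417 pairs where Kim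
2026's `p ≥ 5` binds alone) contains 861 (M) + 245 (e = 2, twist ordinary) rank-`0` pairs whose
twist `E♭ = E ⊗ χ_{−3}` is semistable at `3`. For those, the divisibility input is KATO's, not
Wuthrich's. The PRINTED sources differ with the reduction type of `E♭` at `p` (referee nit
`chiBranch-Kato174-mult-shape-cite`, R106.10, corrected here — docstrings only, the `def` below is
byte-identical): (i) `E♭` GOOD ORDINARY at `p`: K. Kato, Astérisque 295 (2004), Thm. 17.4 (3) with
Thm. 12.5 (4) — Kato's §17 assumes `p ∤ N` (Prop. 17.1 (i), p. 272), so Thm. 17.4 is a statement at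
primes of GOOD (ordinary) reduction only — for `ρ_{E♭,p^∞}` with image containing `SL₂(ℤ_p)`
((12.5.2), implied by surjectivity onto `GL₂(ℤ_p)`), the characteristic ideal of `X(E♭)` over the
cyclotomic tower `ℚ(ζ_{p^∞})` divides `(L_p(E♭))` integrally ("`p ≠ 2`" only); (ii) `E♭`
MULTIPLICATIVE at `p`: NOT Kato's Thm. 17.4 but the divisibility as ATTRIBUTED to Kato by Wuthrich
2014, Thm. 3 (p. 383: "We formulate it here for the full cyclotomic `ℤ_p^×`-extension … This theorem
was proven by Kato in [10] in the case that the reduction is ordinary and the representation on the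
Tate module was surjective", semistable `p`) together with the first case of the proof of his
Cor. 19 (p. 399) — the cell's reading CITED-FACTS A32 / A105 / A108 (flag `Wu14-surj-attribution`).
Either is composed, as in [B∘C], with the classical prime-to-`p` descent
`X(E/ℚ_∞) ≅ X(E♭/ℚ(μ_{p^∞}))^{(χ)}` [C] (Greenberg LNM 1716 §5; folklore, hence TYPED). At `p = 3`
surjectivity onto `GL₂(ℤ/3)` does NOT imply
`3`-adic surjectivity, so the binder is `∀ n, ρ̄_{V,p^n}` onto (per-pair checkable: adelic image
labels), exactly the spelling of the tree's `kato_divisibility` clause (3):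

* `ChiBranchLeadingTermOddBigImageAt W p` — for `W` additive `ℚ`-isomorphic to `V^{(−p)}`, `V`
  globally minimal good ordinary or multiplicative at `p` with `ρ_{V,p^∞}` SURJECTIVE, `f` the
  newform of `V`, `κ/γ` cyclotomic, `D` a Selmer-dual datum of `W` over `ℚ_∞`,
  `ϖ⁻ · |Ω⁻(V)| = Ω⁻_f`: `X(W/ℚ_∞)` is `Λ`-torsion and some `g ∈ char_Λ X(W/ℚ_∞)` has
  `g(0) = u · ϖ⁻ · ∑_{a mod p} (a/p)[a/p]⁻_f`, `u ∈ ℤ_p^×`.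
Consumer: `Additive/X4RankZeroSemistableTwistOdd.lean`.

References: Kato 2004 [Kato2004Asterisque] Thm. 17.4 (3), Prop. 17.1 (i), Thm. 12.5 (4), (12.5.2)
(good ordinary `E♭`); Wuthrich 2014 [Wuthrich2014] Thm. 3 (p. 383, attribution to Kato; semistable `p`)
and Cor. 19 (p. 399, first case of the proof) (multiplicative `E♭`); Mazur–Tate–Teitelbaum 1986
[MazurTateTeitelbaum1986Invent] §I.14; Greenberg 1999 [GreenbergLNM1716] §5.
-/

noncomputable section

open scoped Classical MatrixGroups ModularForm

open CongruenceSubgroup WeierstrassCurve Literature.NumberTheory.EllipticCurves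
  Literature.NumberTheory.EllipticCurves.ModularForms
  Literature.NumberTheory.EllipticCurves.Rank1Residual

namespace Summit.BirchSwinnertonDyer.Rank1Residual.Additive

/-! ### The typed input, odd branch, big image -/

/-- **[B'∘C] at the trivial character, ODD branch (`p ≡ 3 (mod 4)`), BIG IMAGE, TYPED** — the
missing input of line V9b at `(E, p)`. For the additive curve `E = W` at `p ≡ 3 (mod 4)`: whenever
`W` is `ℚ`-isomorphic to the quadratic twist by `−p` of a globally minimal `V` (`E♭`) that is good
ordinary or multiplicative at `p` with `ρ_{V,p^∞}` SURJECTIVE (`ρ̄_{V,p^n}` onto for every `n`),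
`f` the newform of `V`, `κ`/`γ` the cyclotomic `ℤ_p`-extension with a topological generator
matching the cyclotomic variable, `D` a Pontryagin-dual datum of `Sel_{p^∞}(W/ℚ_∞)` and
`ϖ⁻ · |Ω⁻(V)| = Ω⁻_f`, then `X(W/ℚ_∞)` is `Λ`-torsion and SOME `g ∈ char_Λ X(W/ℚ_∞)` has
`g(0) = u · ϖ⁻ · ∑_{a mod p} (a/p)[a/p]⁻_f`, `u ∈ ℤ_p^×` — the `T = 0` specialisation of
"`char X(E/ℚ_∞) ∋` the `χ_{−p}`-branch of Kato's `L_p(E♭)`-divisibility" (for `E♭` GOOD ORDINARY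
at `p`: Kato 2004 Thm. 17.4 (3) / 12.5 (4) for `E♭` over `ℚ(ζ_{p^∞})`, `p ≠ 2`, (12.5.2) — Kato's §17
has `p ∤ N`, Prop. 17.1 (i); for `E♭` MULTIPLICATIVE at `p`: the divisibility over `ℚ(ζ_{p^∞})`
attributed to Kato by Wuthrich 2014 Thm. 3 (p. 383) with the first case of the proof of his Cor. 19
(p. 399), reading A32/A105/A108, flag `Wu14-surj-attribution`; `ω^{(p−1)/2}`-component;
transported along `X(E/ℚ_∞) ≅ X(E♭/ℚ(μ_{p^∞}))^{(χ)}`; value at `T = 0` by Mazur–Tate–Teitelbaum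
§I.14 with the minus symbol). A predicate on `(W, p)`; its universal closure is NOT asserted.
Big-image twin of `ChiBranchLeadingTermOddAt` (there: `E[p]` reducible, Wuthrich 2014 Thm. 16).
[cite: Kato2004Asterisque, Thm. 17.4 (3) (p. 273) and Prop. 17.1 (i) (p. 272) (good ordinary E♭; shape only; nothing asserted)]
[cite: Wuthrich2014, Thm. 3 (p. 383) and Cor. 19 (p. 399) (multiplicative E♭, attribution to Kato; shape only; nothing asserted)]
[cite: MazurTateTeitelbaum1986Invent, §I.14 (shape only; nothing asserted)] -/
def ChiBranchLeadingTermOddBigImageAt (W : WeierstrassCurve ℚ) (p : ℕ) [Fact p.Prime] : Prop :=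
  ∀ (V : WeierstrassCurve ℚ) [V.IsElliptic] [V.IsGloballyMinimal]
    {κ : ZpExtension ℚ p} {γ : Field.absoluteGaloisGroup ℚ} {N : ℕ} [NeZero N]
    {f : CuspForm (Gamma0 N) 2},
    p % 4 = 3 →
    (∃ C : VariableChange ℚ, C • V.quadraticTwist (-(p : ℚ)) = W) →
    (GoodOrd V p ∨ Mult V p) → (∀ n : ℕ, V.HasSurjectiveModNGaloisRep (p ^ n : ℕ)) →
    κ.IsCyclotomic → κ.IsTopGenerator γ → IsCyclotomicVariable p γ → IsNewformOf V f →
    ∀ (D : W.SelmerDualData κ γ) (ϖ : ℚ), (ϖ : ℝ) * V.imaginaryPeriodRat = minusPeriod f →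
      D.IsTorsion ∧
      ∃ g ∈ D.charIdeal, ∃ u : ℤ_[p]ˣ,
        ((PowerSeries.constantCoeff g : ℤ_[p]) : ℚ_[p]) =
          ((u : ℤ_[p]) : ℚ_[p]) * (ϖ : ℚ_[p]) * (legendreMinusSymbolSum f p : ℚ_[p])

/-- Unfolding lemma for `ChiBranchLeadingTermOddBigImageAt`. -/
theorem chiBranchLeadingTermOddBigImageAt_iff (W : WeierstrassCurve ℚ) (p : ℕ) [Fact p.Prime] :
    ChiBranchLeadingTermOddBigImageAt W p ↔
      ∀ (V : WeierstrassCurve ℚ) [V.IsElliptic] [V.IsGloballyMinimal]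
        {κ : ZpExtension ℚ p} {γ : Field.absoluteGaloisGroup ℚ} {N : ℕ} [NeZero N]
        {f : CuspForm (Gamma0 N) 2},
        p % 4 = 3 →
        (∃ C : VariableChange ℚ, C • V.quadraticTwist (-(p : ℚ)) = W) →
        (GoodOrd V p ∨ Mult V p) → (∀ n : ℕ, V.HasSurjectiveModNGaloisRep (p ^ n : ℕ)) →
        κ.IsCyclotomic → κ.IsTopGenerator γ → IsCyclotomicVariable p γ → IsNewformOf V f →
        ∀ (D : W.SelmerDualData κ γ) (ϖ : ℚ), (ϖ : ℝ) * V.imaginaryPeriodRat = minusPeriod f →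
          D.IsTorsion ∧
          ∃ g ∈ D.charIdeal, ∃ u : ℤ_[p]ˣ,
            ((PowerSeries.constantCoeff g : ℤ_[p]) : ℚ_[p]) =
              ((u : ℤ_[p]) : ℚ_[p]) * (ϖ : ℚ_[p]) * (legendreMinusSymbolSum f p : ℚ_[p]) :=
  Iff.rfl

end Summit.BirchSwinnertonDyer.Rank1Residual.Additive

end
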